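import Summits.Ventures.PercRepro.Night2TwoOneColumnB

/-!
# PercRepro — the cell `(2, 1)` with two fat closures: the lossy basis pairs and the complete targets
(night-2, gen 28)

Spread regime of the two-fat-closure clause (`Night2TwoOneColumnB`).  A lossy basis pair `(B, z)` has its covering
basis `X = (B ∪ {z}) ∖ K` with exactly three points on the plane `P` and one point of each class (fewer plane points
lose nothing, `faceLoss_sum_eq_zero_of_two_off_plane`; more are dependent; two points of one class put `X` inside a
hyperplane) — its profile along `P` is `(3, 2)` (**`profile_of_lossy_basis_pair`**).  A target containing all four
off-plane points has no thin face at a class point, hence at most three thin faces, all at plane points and not fat: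
`L1 ≤ 3 · 7/54` (**`L1_le_of_complete`**).
-/

namespace PercRepro.Shadow

open Finset PerFlat ThmH

variable {α : Type*} [DecidableEq α] {M : Matroid α} [M.Finite]

section Floors

variable {G : Finset α}

/-- The plane of two fat closures with disjoint missed pairs has rank `≤ 3`. -/
theorem rkN_plane_le_three_of_disj (hG : G ∈ flatsQ M (5 + 1)) (hd : (gr M \ G).card = 2)
    (hk : kColoops M G = 1) {B₀ B₁ : Finset α} (hB₀ : B₀ ∈ thinMembers M 5 G) (hB₁ : B₁ ∈ thinMembers M 5 G)
    (hdisj : Disjoint (G \ clF M B₀) (G \ clF M B₁)) :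
    rkN M ((clF M B₀ ∩ clF M B₁) \ coloops M G) ≤ 3 := by
  have hd' : (gr M \ G).card ≤ 5 := by omega
  obtain ⟨b, hb⟩ := Finset.card_pos.1 (by
    have := two_le_card_sdiff_of_not_lay0 hG hd' (mem_thinMembers.1 hB₁).1 (mem_thinMembers.1 hB₁).2
    omega : 0 < (G \ clF M B₁).card)
  have hbH₀ : b ∈ clF M B₀ := by
    by_contra h
    exact Finset.disjoint_left.1 hdisj (Finset.mem_sdiff.2 ⟨(Finset.mem_sdiff.1 hb).1, h⟩) hb
  have := rkN_plane_le_three_of_meet hG hd hk hB₀ hB₁ hbH₀ (Finset.mem_sdiff.1 hb).2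
  rwa [Finset.inter_comm] at this

/-- A point of `G ∖ K` off the plane lies in one of the two classes. -/
theorem mem_classes_of_notMem_plane {B₀ B₁ : Finset α} {x : α} (hxG : x ∈ G) (hxK : x ∉ coloops M G)
    (hxP : x ∉ (clF M B₀ ∩ clF M B₁) \ coloops M G) : x ∈ (G \ clF M B₀) ∪ (G \ clF M B₁) := by
  rw [Finset.mem_sdiff, Finset.mem_inter, not_and_or, not_and_or] at hxP
  rw [Finset.mem_union, Finset.mem_sdiff, Finset.mem_sdiff]
  rcases hxP with (h | h) | h
  · exact Or.inl ⟨hxG, h⟩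
  · exact Or.inr ⟨hxG, h⟩
  · exact absurd hxK h

open scoped Classical in
/-- **THE PROFILE OF A LOSSY BASIS PAIR IS `(3, 2)`** (cell `(2, 1)`, two fat closures with disjoint missed pairs):
its covering basis `X = (B ∪ {z}) ∖ K` has three points on the plane (of rank `3`) and one point of each class. -/
theorem profile_of_lossy_basis_pair (hG : G ∈ flatsQ M (5 + 1)) (hd : (gr M \ G).card = 2)
    (hk : kColoops M G = 1) {B₀ B₁ : Finset α} (hB₀ : B₀ ∈ thinMembers M 5 G) (hB₁ : B₁ ∈ thinMembers M 5 G)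
    (hm₀ : (G \ clF M B₀).card ≤ 2) (hm₁ : (G \ clF M B₁).card ≤ 2) (hne : clF M B₀ ≠ clF M B₁)
    (hdisj : Disjoint (G \ clF M B₀) (G \ clF M B₁)) {B : Finset α} (hB : B ∈ thinMembers M 5 G)
    (hB4 : (B \ coloops M G).card + 1 = 5) {z : α} (hz : z ∈ G \ clF M B) (hl0 : loss M 5 G B z ≠ 0) :
    ((insert z B \ coloops M G) ∩ ((clF M B₀ ∩ clF M B₁) \ coloops M G)).card = 3 ∧
      ((insert z B \ coloops M G) \ ((clF M B₀ ∩ clF M B₁) \ coloops M G)).card = 2 ∧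
      3 ≤ rkN M ((insert z B \ coloops M G) ∩ ((clF M B₀ ∩ clF M B₁) \ coloops M G)) ∧
      (∃ u ∈ insert z B, u ∈ G \ clF M B₀) ∧ ∃ u' ∈ insert z B, u' ∈ G \ clF M B₁ := by
  have hd' : (gr M \ G).card ≤ 5 := by omega
  have hGg : G ⊆ gr M := (mem_flatsQ.1 hG).1
  have hB' : B ∈ membersIn M (Uq M (5 + 2) 5) G := (mem_thinMembers.1 hB).1
  have hBU : B ∈ Uq M (5 + 2) 5 := (mem_membersIn.1 hB').1
  have hBG : B ⊆ G := (subset_clF hBU).trans (mem_membersIn.1 hB').2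
  have hKB : coloops M G ⊆ B := coloops_subset_of_mem_thinMembers hG hd' hB
  have hzB : z ∉ B := notMem_of_notMem_clF hBU (Finset.mem_sdiff.1 hz).2
  have hzK : z ∉ coloops M G := fun h => hzB (hKB h)
  have hzG : z ∈ G := (Finset.mem_sdiff.1 hz).1
  have hP3 := rkN_plane_le_three_of_disj hG hd hk hB₀ hB₁ hdisj
  set P := (clF M B₀ ∩ clF M B₁) \ coloops M G with hPdef
  set X := insert z B \ coloops M G with hXdef
  have hXeq : X = insert z (B \ coloops M G) := by rw [hXdef, Finset.insert_sdiff_of_notMem _ hzK]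
  have hX5 : X.card = 5 := by
    rw [hXeq, Finset.card_insert_of_notMem (fun h => hzB (Finset.mem_sdiff.1 h).1)]
    omega
  have hXV : X ⊆ G \ coloops M G :=
    Finset.sdiff_subset_sdiff (Finset.insert_subset hzG hBG) (Finset.Subset.refl _)
  have hXg : X ⊆ gr M := hXV.trans (Finset.sdiff_subset.trans hGg)
  have hXr : rkN M X = 5 := rkN_insert_sdiff_coloops_eq_five_of_thin hG hd hk hB hz
  have hXI : M.Indep (X : Set α) := indep_of_rkN_eq_card (by rw [hXr, hX5])
  -- at most three plane points (independent, inside a rank-`3` set)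
  have hle3 : (X ∩ P).card ≤ 3 := by
    have hI : M.Indep ((X ∩ P : Finset α) : Set α) :=
      hXI.subset (by exact_mod_cast (Finset.inter_subset_left : X ∩ P ⊆ X))
    have h1 := rkN_eq_card_of_indep hI
    have h2 : rkN M (X ∩ P) ≤ rkN M P := rkN_mono Finset.inter_subset_right
    omega
  -- at least three plane points: otherwise no loss
  have hge3 : 3 ≤ (X ∩ P).card := by
    by_contra hlt
    push Not at hlt
    have hsum := faceLoss_sum_eq_zero_of_two_off_plane hG hd hk hB₀ hB₁ hm₀ hm₁ hne hXV hX5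
      (by rw [← hPdef]; omega)
    have hz' : z ∈ X := by rw [hXeq]; exact Finset.mem_insert_self _ _
    have hterm : faceLoss M 5 G (coloops M G ∪ X) z = 0 :=
      (Finset.sum_eq_zero_iff_of_nonneg (fun w _ => faceLoss_nonneg hG hd' _ w)).1 hsum z hz'
    have hKX : coloops M G ∪ X = insert z B := by
      rw [hXdef, Finset.union_sdiff_self_eq_union, Finset.union_eq_right.2 (hKB.trans (Finset.subset_insert _ _))]
    have hBeq : (insert z B).erase z = B := Finset.erase_insert hzB
    unfold faceLoss at hterm
    rw [hKX, hBeq, if_pos ⟨hB, hz⟩] at hterm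
    exact hl0 hterm
  have hcard : (X \ P).card + (X ∩ P).card = X.card := Finset.card_sdiff_add_card_inter X P
  have hXP3 : (X ∩ P).card = 3 := le_antisymm hle3 hge3
  refine ⟨hXP3, by omega, ?_, ?_, ?_⟩
  · have hI : M.Indep ((X ∩ P : Finset α) : Set α) :=
      hXI.subset (by exact_mod_cast (Finset.inter_subset_left : X ∩ P ⊆ X))
    rw [rkN_eq_card_of_indep hI, hXP3]
  -- a point of the class `G ∖ H₀`: otherwise `X ⊆ H₀`, rank `≤ 4`
  · by_contra hcon
    push Not at hcon
    have hsub : X ⊆ clF M B₀ \ coloops M G := by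
      intro x hx
      have hxV := hXV hx
      rw [Finset.mem_sdiff] at hxV ⊢
      refine ⟨?_, hxV.2⟩
      by_contra h
      exact hcon x (Finset.mem_sdiff.1 hx).1 (Finset.mem_sdiff.2 ⟨hxV.1, h⟩)
    have h1 := rkN_mono (M := M) hsub
    have h2 := rkN_clF_sdiff_coloops_le_four_two hG hd hk hB₀
    omega
  · by_contra hcon
    push Not at hcon
    have hsub : X ⊆ clF M B₁ \ coloops M G := by
      intro x hx
      have hxV := hXV hx
      rw [Finset.mem_sdiff] at hxV ⊢
      refine ⟨?_, hxV.2⟩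
      by_contra h
      exact hcon x (Finset.mem_sdiff.1 hx).1 (Finset.mem_sdiff.2 ⟨hxV.1, h⟩)
    have h1 := rkN_mono (M := M) hsub
    have h2 := rkN_clF_sdiff_coloops_le_four_two hG hd hk hB₁
    omega

open scoped Classical in
/-- **A TARGET CONTAINING ALL FOUR OFF-PLANE POINTS REQUESTS AT MOST `3 · 7/54`**: no thin face at a class point, at
most three coloops, every remaining face is at a plane point and not fat. -/
theorem L1_le_of_complete (hG : G ∈ flatsQ M (5 + 1)) (hd : (gr M \ G).card = 2) (hk : kColoops M G = 1)
    (hs : ∀ e ∈ gr M, ∀ f ∈ gr M, e ≠ f → rkN M {e, f} = 2) (hl : ∀ e ∈ gr M, M.Indep {e})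
    {B₀ B₁ : Finset α} (hB₀ : B₀ ∈ thinMembers M 5 G) (hB₁ : B₁ ∈ thinMembers M 5 G)
    (hm₀ : (G \ clF M B₀).card ≤ 2) (hm₁ : (G \ clF M B₁).card ≤ 2) (hne : clF M B₀ ≠ clF M B₁)
    (hfat : (fatClosures M 5 G 2).card ≤ 2)
    (hsp : ∀ B ∈ thinMembers M 5 G, 2 < (G \ clF M B).card → 7 ≤ (G \ clF M B).card)
    (hdisj : Disjoint (G \ clF M B₀) (G \ clF M B₁)) {S : Finset α} (hSG : S ⊆ G)
    (hS5 : rkN M (S \ coloops M G) = 5) (hS6 : 6 ≤ (S \ coloops M G).card)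
    (hSP3 : 3 ≤ rkN M (S ∩ ((clF M B₀ ∩ clF M B₁) \ coloops M G)))
    (hA : G \ clF M B₀ ⊆ S) (hB : G \ clF M B₁ ⊆ S) : L1 M 5 G S ≤ 7 / 18 := by
  have hd' : (gr M \ G).card ≤ 5 := by omega
  have hGg : G ⊆ gr M := (mem_flatsQ.1 hG).1
  have hA2 : (G \ clF M B₀).card = 2 := by
    have := two_le_card_sdiff_of_not_lay0 hG hd' (mem_thinMembers.1 hB₀).1 (mem_thinMembers.1 hB₀).2
    omega
  have hB2 : (G \ clF M B₁).card = 2 := by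
    have := two_le_card_sdiff_of_not_lay0 hG hd' (mem_thinMembers.1 hB₁).1 (mem_thinMembers.1 hB₁).2
    omega
  obtain ⟨u, hu⟩ := Finset.card_pos.1 (by omega : 0 < (G \ clF M B₀).card)
  obtain ⟨u', hu'⟩ := Finset.card_pos.1 (by omega : 0 < (G \ clF M B₁).card)
  have huS : u ∈ S ∩ (G \ clF M B₀) := Finset.mem_inter.2 ⟨hA hu, hu⟩
  have hu'S : u' ∈ S ∩ (G \ clF M B₁) := Finset.mem_inter.2 ⟨hB hu', hu'⟩
  set Pre := (coverPreimages M (Uq M (5 + 2) 5) G S).filter (fun B => B ∉ lay0 M 5 G) with hPre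
  set W := (coloops M (S \ coloops M G)).filter (fun w => S.erase w ∈ Pre) with hW
  have hthin : ∀ F ∈ Pre, F ∈ thinMembers M 5 G := by
    intro F hF
    rw [hPre, Finset.mem_filter, mem_coverPreimages] at hF
    exact mem_thinMembers.2 ⟨hF.1.1, hF.2⟩
  have hnotcl : ∀ w ∈ S, S.erase w ∈ Pre → w ∉ clF M (S.erase w) := by
    intro w hw hF
    rw [hPre, Finset.mem_filter, mem_coverPreimages] at hF
    obtain ⟨z, hz, hzS⟩ := mem_coverSets.1 hF.1.2
    have hzS' : z ∈ S := by rw [← hzS]; exact Finset.mem_insert_self _ _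
    have hzne : z ∉ S.erase w := notMem_of_notMem_clF (mem_membersIn.1 hF.1.1).1 (Finset.mem_sdiff.1 hz).2
    have hzw : z = w := by
      by_contra h
      exact hzne (Finset.mem_erase.2 ⟨h, hzS'⟩)
    have := (Finset.mem_sdiff.1 hz).2
    rwa [hzw] at this
  have hPreEq : Pre = W.image (fun w => S.erase w) := by
    ext F
    rw [Finset.mem_image]
    constructor
    · intro hF
      have h1 := thin_coverPreimages_subset_image_coloops hG hd' S hF
      obtain ⟨w, hw, rfl⟩ := Finset.mem_image.1 h1
      exact ⟨w, Finset.mem_filter.2 ⟨hw, hF⟩, rfl⟩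
    · rintro ⟨w, hw, rfl⟩
      exact (Finset.mem_filter.1 hw).2
  have hWS : ∀ w ∈ W, w ∈ S :=
    fun w hw => (Finset.mem_sdiff.1 (mem_coloops.1 (Finset.mem_filter.1 hw).1).1).1
  have hL1 : L1 M 5 G S = ∑ w ∈ W, req M 5 (S.erase w) := by
    unfold L1
    rw [← hPre, hPreEq]
    apply Finset.sum_image
    intro w hw w' hw' heq
    exact Finset.erase_injOn S (hWS w hw) (hWS w' hw') heq
  -- every face of `W` is at a plane point
  have hplane : ∀ w ∈ W, w ∈ clF M B₀ ∩ clF M B₁ := by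
    intro w hw
    have hwS := hWS w hw
    have hthinw := hthin _ (Finset.mem_filter.1 hw).2
    have hwK : w ∉ coloops M G := (Finset.mem_sdiff.1 (mem_coloops.1 (Finset.mem_filter.1 hw).1).1).2
    rw [Finset.mem_inter]
    by_contra hcon
    rw [not_and_or] at hcon
    rcases hcon with h | h
    · have hsing := class_inter_eq_singleton_of_thin_face hG hd hk hB₀ hB₁ hdisj hSP3 hu'S
        (Finset.mem_inter.2 ⟨hwS, Finset.mem_sdiff.2 ⟨hSG hwS, h⟩⟩) hthinw
      have : (G \ clF M B₀) ∩ S = G \ clF M B₀ := Finset.inter_eq_left.2 hA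
      rw [this] at hsing
      have := congrArg Finset.card hsing
      rw [hA2, Finset.card_singleton] at this
      omega
    · have hsing := class_inter_eq_singleton_of_thin_face' hG hd hk hB₀ hB₁ hdisj hSP3 huS
        (Finset.mem_inter.2 ⟨hwS, Finset.mem_sdiff.2 ⟨hSG hwS, h⟩⟩) hthinw
      have : (G \ clF M B₁) ∩ S = G \ clF M B₁ := Finset.inter_eq_left.2 hB
      rw [this] at hsing
      have := congrArg Finset.card hsing
      rw [hB2, Finset.card_singleton] at this
      omega
  have hWcard : W.card ≤ 3 :=
    (Finset.card_le_card (Finset.filter_subset _ _)).trans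
      (card_coloops_le_three hs hl (Finset.sdiff_subset.trans (hSG.trans hGg)) hS5 hS6)
  rw [hL1]
  calc ∑ w ∈ W, req M 5 (S.erase w) ≤ ∑ _w ∈ W, (7 / 54 : ℚ) := by
        apply Finset.sum_le_sum
        intro w hw
        exact req_le_of_plane_face hG hd hB₀ hB₁ hm₀ hm₁ hne hfat hsp (hthin _ (Finset.mem_filter.1 hw).2)
          (hplane w hw) (hnotcl w (hWS w hw) (Finset.mem_filter.1 hw).2)
    _ = (W.card : ℚ) * (7 / 54) := by rw [Finset.sum_const, nsmul_eq_mul]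
    _ ≤ 3 * (7 / 54) := by
        apply mul_le_mul_of_nonneg_right _ (by norm_num)
        exact_mod_cast hWcard
    _ = 7 / 18 := by norm_num

end Floors

end PercRepro.Shadow
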